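import Summits.Schanuel.Schanuel.Theorems.RootDecomp1KSkelCell01

/-!
# RootDecomp1KSkelCell — lens 1, generations 43–44 «THE QUALITY-ONLY CLASS SkelLiouville ⊋ LogLogLiouville AND ITS CERTIFIED MEMBER ρ⋆» (PRICE K-α L2033, CLAIM L2045, ACK L2046; (α) PROPER of the 1K wall map): the location-free class `SkelLiouville ρ := ∀ m ∃ r, m ≤ den r ∧ ρ ≠ r ∧ |ρ − r| < den^{−m·ι(den)}` (ι q = least N with q ≤ 2^{N!}) with `LogLogLiouville ⊊ SkelLiouville ⊆ Liouville` PROVED, the member ρ⋆ = Σ_j 2^{−2^{e_j}} (FREDHOLM SERIES WITH DELETED BLOCKS) certified HYPOTHESIS-FREE in Skel ∖ (LogLog ∪ FactorialGap), the SKEL engine + extraction, the walls (1, ℓ₂, ρ) mod hNW / π-twins and the pair (ℓ₂, ρ) HYPOTHESIS-FREE for every ρ ∈ Skel, the items APPLIED at z⋆ with all binders discharged, the m = 1 ceiling, and §9 hNW DISCHARGED BY NAME on the e-wall via the Literature proof module — continuation (RootDecomp1KSkelCell02): §5a anchors + §5b skeleton, positions, terms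

(lens-1 g43/g44 HOME kernel SkelCell.lean EDITION 2 b7163857…, 2822 l, imports tree RootDecomp1KGapCell01 (+ for §9 only Literature ExpOneTranscendenceMeasureProofs); CLAIM L2045, ACK L2046 (CHECKLIST K-α (1)–(8) + the constant-dependence line of L2085 (R4)), NODE L2132 / REQUEST L2133, critic VERDICT L2140 (crit g9: CLEARED — ONE CELL credit (K-α); lens-1 tally credits ×11 + THEOREM; PORT GO in substance 01–0k `--supports stmt-Schanuel-33364`, the two scoped heartbeat raises flagged for the port record, addendum D as RootDecomp1KNWMeasureHolds GO LOW); port by census-1 gen 18 as `RootDecomp1KSkelCell01`–`11` along K's sections: 01 = §1 `iota`, `SkelLiouville`, inclusions `SkelLiouville.liouville` / `logLogLiouville_skelLiouville`; 02 = §5a anchors `aI`/`sI` + §5b the skeleton `eS`, positions `cS`, terms `aS` (up to `summable_aS`); 03 = §5b the member `rhoStar`, truncations `tS`/`rS`, bounds + §6 covering / quality lemmas; 04 = §6 THE MEMBER THEOREMS `skelLiouville_rhoStar`, `not_logLogLiouville_rhoStar`, `not_factorialGapLiouville_rhoStar`, `liouville_rhoStar`, `not_skelLiouville_subset_logLogLiouville`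 + §2 engine preliminaries (`SkelMeasure`, `exists_scale_index_iota`); 05 = §2 THE ENGINE `skelMeasure_cons_liouvilleNumber` (scoped `maxHeartbeats 800000` as in K) + `SkelMeasure.mvWeakMeasure`; 06 = §3 EXTRACTION `no_int_relation_of_skelMeasure_skelLiouville`, `sb_of_skelLiouville_of_skelMeasure`; 07 = §4 THE CELLS (pair hyp-free, walls mod hNW, π-twins) + the live items in item shape; 08 = §7 three interlaced cuts `deletedBlock_margins`, `form_lower_bound_S` (scoped `maxHeartbeats 1600000`); 09 = §7b member tuples zS2/zS3/zS3pi, scope certificates, items AT the members; 10 = §8 the fixed-multiple ladder and the m = 1 ceiling (`uStar`, `skel_fixedOne_ceiling`); 11 = §9 hNW DISCHARGED BY NAME (imports Literature ExpOneTranscendenceMeasureProofs).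
PORT EDITS: `set_option linter.dupNamespace false` dropped; the Literature import moved from the head to part 11 (the only user); K's 13 private helpers travel as per-part private copies; two generic helpers made `private` after the dedup bounce of 02 (p829539: `two_mul_le_two_pow` ≡ Literature.NumberTheory.EllipticCurves.two_mul_le_two_pow; also `log_two_lt_self` pre-emptively); statements and proofs verbatim. `--supports stmt-Schanuel-33364`; no census credit carried; rung 0 — nothing here proves Schanuel.)
-/

open Summit.Schanuel.Schanuel.Theorems.RootDecomp1KHyper
open Summit.Schanuel.Schanuel.Theorems.RootDecomp1KHyper.HyperCell
open Summit.Schanuel.Schanuel.Theorems.RootDecomp1KGeneric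
open Summit.Schanuel.Schanuel.Theorems.RootDecomp1KRelLiouvilleCell
open Summit.Schanuel.Schanuel.Theorems.RootDecomp1KLogLogCell
open Summit.Schanuel.Schanuel.Theorems.RootDecomp1KTwoBaseCell
open Summit.Schanuel.Schanuel.Theorems.RootDecomp1KGapCell
open LiouvilleNumber
open scoped Nat

namespace Summit.Schanuel.Schanuel.Theorems.RootDecomp1KSkelCell

/-! ## §5a  Anchors `a_i = ⌊log₂ (2^i)!⌋ + 1` and hole lengths `s_i = i + ⌊log₂ i⌋` -/

section Anchors

/-- anchor exponent: `2^{a_i}` is the least power of two above `(2^i)!`. -/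
def aI (i : ℕ) : ℕ := Nat.log 2 ((2 ^ i)!) + 1

/-- hole length at anchor `i`: the deleted block of exponents is `(a_i, a_i + s_i)`. -/
def sI (i : ℕ) : ℕ := i + Nat.log 2 i

/-- `(2^i)! < 2^{a_i}`. -/
theorem factorial_lt_two_pow_aI (i : ℕ) : (2 ^ i)! < 2 ^ aI i :=
  Nat.lt_pow_succ_log_self one_lt_two _

/-- `2^{a_i} ≤ 2 · (2^i)!`. -/
theorem two_pow_aI_le (i : ℕ) : 2 ^ aI i ≤ 2 * (2 ^ i)! := by
  have h := Nat.pow_log_le_self 2 (Nat.factorial_ne_zero (2 ^ i))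
  unfold aI; rw [pow_succ]; omega

/-- `2^{a_i} ≤ (2^i + 1)!`. -/
theorem two_pow_aI_le_factorial_succ (i : ℕ) : 2 ^ aI i ≤ (2 ^ i + 1)! := by
  rw [Nat.factorial_succ]
  have h1 := two_pow_aI_le i
  have h2 : 2 * (2 ^ i)! ≤ (2 ^ i + 1) * (2 ^ i)! :=
    Nat.mul_le_mul_right _ (by have := Nat.one_le_two_pow (n := i); omega)
  exact h1.trans h2

/-- `i + 1 ≤ a_i`. -/
theorem succ_le_aI (i : ℕ) : i + 1 ≤ aI i := by
  have h : 2 ^ i ≤ (2 ^ i)! := Nat.self_le_factorial _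
  have h2 : i ≤ Nat.log 2 ((2 ^ i)!) :=
    Nat.le_log_of_pow_le one_lt_two h
  unfold aI; omega

/-- `a_i + 2^i ≤ a_{i+1}` (from `m!·(m+1)^n ≤ (m+n)!`). -/
theorem aI_add_two_pow_le (i : ℕ) : aI i + 2 ^ i ≤ aI (i + 1) := by
  have h1 : (2 ^ i)! * (2 ^ i + 1) ^ (2 ^ i) ≤ (2 ^ (i + 1))! := by
    have h := @Nat.factorial_mul_pow_le_factorial (2 ^ i) (2 ^ i)
    rwa [← two_mul, ← pow_succ'] at h
  have h2 : 2 ^ (Nat.log 2 ((2 ^ i)!) + 2 ^ i) ≤ (2 ^ (i + 1))! := by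
    rw [pow_add]
    calc 2 ^ Nat.log 2 ((2 ^ i)!) * 2 ^ (2 ^ i) ≤ (2 ^ i)! * (2 ^ i + 1) ^ (2 ^ i) :=
          Nat.mul_le_mul (Nat.pow_log_le_self 2 (Nat.factorial_ne_zero _))
            (Nat.pow_le_pow_left (by have := Nat.one_le_two_pow (n := i); omega) _)
      _ ≤ _ := h1
  have h3 := Nat.le_log_of_pow_le one_lt_two h2
  unfold aI; omega

/-- `2 i ≤ 2^i`. -/
private theorem two_mul_le_two_pow (i : ℕ) : 2 * i ≤ 2 ^ i := by
  induction i with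
  | zero => simp
  | succ i ih =>
    rcases Nat.eq_zero_or_pos i with h | h
    · subst h; simp
    · have h2 : 2 ≤ 2 ^ i := by
        calc 2 = 2 ^ 1 := by norm_num
          _ ≤ 2 ^ i := Nat.pow_le_pow_right two_pos h
      rw [pow_succ]; omega

/-- `⌊log₂ i⌋ < i` (`i ≥ 1`). -/
private theorem log_two_lt_self {i : ℕ} (hi : 1 ≤ i) : Nat.log 2 i < i :=
  (Nat.log_lt_iff_lt_pow one_lt_two (by omega)).mpr Nat.lt_two_pow_self

/-- `s_i < 2^i`. -/
theorem sI_lt_two_pow (i : ℕ) : sI i < 2 ^ i := by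
  unfold sI
  rcases Nat.eq_zero_or_pos i with h | h
  · subst h; simp
  · have h1 := log_two_lt_self h
    have h2 := two_mul_le_two_pow i
    omega

/-- the holes are disjoint from the later anchors: `a_i + s_i < a_{i+1}`. -/
theorem aI_add_sI_lt (i : ℕ) : aI i + sI i < aI (i + 1) := by
  have := aI_add_two_pow_le i; have := sI_lt_two_pow i; omega

/-- `a` is strictly increasing. -/
theorem aI_strictMono : StrictMono aI :=
  strictMono_nat_of_lt_succ fun i => by
    have := aI_add_two_pow_le i; have := Nat.one_le_two_pow (n := i); omega

/-- `4 ≤ s_i` (`i ≥ 4`). -/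
theorem four_le_sI {i : ℕ} (hi : 4 ≤ i) : 4 ≤ sI i := by unfold sI; omega

/-- `i ≤ s_i`. -/
theorem le_sI (i : ℕ) : i ≤ sI i := by unfold sI; omega

/-- `2^i (i+1) ≤ 2 · 2^{s_i}`. -/
theorem two_pow_mul_succ_le (i : ℕ) : 2 ^ i * (i + 1) ≤ 2 * 2 ^ sI i := by
  have h : i < 2 ^ (Nat.log 2 i + 1) := Nat.lt_pow_succ_log_self one_lt_two i
  unfold sI
  calc 2 ^ i * (i + 1) ≤ 2 ^ i * 2 ^ (Nat.log 2 i + 1) := Nat.mul_le_mul_left _ h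
    _ = 2 * 2 ^ (i + Nat.log 2 i) := by ring

/-- `2^{s_i} ≤ 2^i · i` (`i ≥ 1`). -/
theorem two_pow_sI_le {i : ℕ} (hi : 1 ≤ i) : 2 ^ sI i ≤ 2 ^ i * i := by
  unfold sI; rw [pow_add]
  exact Nat.mul_le_mul_left _ (Nat.pow_log_le_self 2 (by omega))

/-- `k·2^k + 1 ≤ a_{k+1}`. -/
theorem mul_two_pow_lt_aI (k : ℕ) : k * 2 ^ k + 1 ≤ aI (k + 1) := by
  have h1 : (2 ^ k)! * (2 ^ k + 1) ^ (2 ^ k) ≤ (2 ^ (k + 1))! := by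
    have h := @Nat.factorial_mul_pow_le_factorial (2 ^ k) (2 ^ k)
    rwa [← two_mul, ← pow_succ'] at h
  have h2 : 2 ^ (k * 2 ^ k) ≤ (2 ^ (k + 1))! := by
    calc 2 ^ (k * 2 ^ k) = (2 ^ k) ^ (2 ^ k) := by rw [pow_mul]
      _ ≤ (2 ^ k + 1) ^ (2 ^ k) := Nat.pow_le_pow_left (by omega) _
      _ ≤ (2 ^ k)! * (2 ^ k + 1) ^ (2 ^ k) := Nat.le_mul_of_pos_left _ (Nat.factorial_pos _)
      _ ≤ _ := h1
  have h3 := Nat.le_log_of_pow_le one_lt_two h2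
  unfold aI; omega

/-- `2^{s_i} ≤ 8 a_i` (`i ≥ 2`): the hole quality is `O(a_i) = O(log log den)`. -/
theorem two_pow_sI_le_eight_aI {i : ℕ} (hi : 2 ≤ i) : 2 ^ sI i ≤ 8 * aI i := by
  obtain ⟨k, rfl⟩ : ∃ k, i = k + 1 := ⟨i - 1, by omega⟩
  have h1 := two_pow_sI_le (i := k + 1) (by omega)
  have h2 := mul_two_pow_lt_aI k
  have hk : 1 ≤ k := by omega
  have hp := Nat.one_le_two_pow (n := k)
  have h3 : 2 ^ (k + 1) * (k + 1) ≤ 8 * (k * 2 ^ k + 1) := by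
    rw [pow_succ]
    nlinarith
  calc 2 ^ sI (k + 1) ≤ 2 ^ (k + 1) * (k + 1) := h1
    _ ≤ 8 * (k * 2 ^ k + 1) := h3
    _ ≤ 8 * aI (k + 1) := Nat.mul_le_mul_left _ h2

end Anchors

/-! ## §5b  Kept exponents `e_j` (the skeleton with deleted blocks), positions `c_j = 2^{e_j}`,
## the member `ρ⋆ = Σ_j 2^{−c_j}` and its truncations -/

section Member

/-- gap after exponent `x`: `s_i` if `x = a_i` for some `i ≥ 4` (the deleted block `(a_i, a_i + s_i)`),
else `1`. -/
def gapAt (x : ℕ) : ℕ :=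
  1 + ∑ i ∈ (Finset.range (x + 1)).filter (fun i => 4 ≤ i ∧ aI i = x), (sI i - 1)

/-- at an anchor the gap is the hole length. -/
theorem gapAt_aI {i : ℕ} (hi : 4 ≤ i) : gapAt (aI i) = sI i := by
  have hfilter : (Finset.range (aI i + 1)).filter (fun j => 4 ≤ j ∧ aI j = aI i) = {i} := by
    ext j
    simp only [Finset.mem_filter, Finset.mem_range, Finset.mem_singleton]
    constructor
    · rintro ⟨-, -, h⟩; exact aI_strictMono.injective h
    · rintro rfl; exact ⟨by have := succ_le_aI j; omega, hi, rfl⟩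
  unfold gapAt; rw [hfilter, Finset.sum_singleton]; have := four_le_sI hi; omega

/-- off the anchors the gap is `1`. -/
theorem gapAt_eq_one {x : ℕ} (hx : ∀ i, 4 ≤ i → aI i ≠ x) : gapAt x = 1 := by
  have h0 : ∑ i ∈ (Finset.range (x + 1)).filter (fun i => 4 ≤ i ∧ aI i = x), (sI i - 1) = 0 :=
    Finset.sum_eq_zero fun j hj => by
      simp only [Finset.mem_filter] at hj
      exact absurd hj.2.2 (hx j hj.2.1)
  unfold gapAt
  rw [h0]

/-- `1 ≤ gapAt x`. -/
theorem one_le_gapAt (x : ℕ) : 1 ≤ gapAt x := by unfold gapAt; exact Nat.le_add_right _ _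

/-- **kept exponents**: the increasing enumeration of `ℕ ∖ ⋃_{i ≥ 4} (a_i, a_i + s_i)`. -/
def eS : ℕ → ℕ
  | 0 => 0
  | j + 1 => eS j + gapAt (eS j)

/-- `eS 0 = 0`. -/
@[simp] theorem eS_zero : eS 0 = 0 := rfl

/-- `eS (j+1) = eS j + gapAt (eS j)`. -/
theorem eS_succ (j : ℕ) : eS (j + 1) = eS j + gapAt (eS j) := rfl

/-- `eS j < eS (j+1)`. -/
theorem eS_lt_succ (j : ℕ) : eS j < eS (j + 1) := by
  rw [eS_succ]; have := one_le_gapAt (eS j); omega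

/-- `eS` is strictly increasing. -/
theorem eS_strictMono : StrictMono eS := strictMono_nat_of_lt_succ eS_lt_succ

/-- `j ≤ eS j`. -/
theorem le_eS (j : ℕ) : j ≤ eS j := by
  induction j with
  | zero => simp
  | succ j ih => have := eS_lt_succ j; omega

/-- the step dichotomy: a filler step (`+1`) or a deleted block at an anchor (`+s_i`). -/
theorem eS_step (j : ℕ) :
    eS (j + 1) = eS j + 1 ∨ ∃ i, 4 ≤ i ∧ eS j = aI i ∧ eS (j + 1) = aI i + sI i := by
  by_cases h : ∃ i, 4 ≤ i ∧ aI i = eS j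
  · obtain ⟨i, hi, he⟩ := h
    exact Or.inr ⟨i, hi, he.symm, by rw [eS_succ, ← he, gapAt_aI hi]⟩
  · push Not at h
    exact Or.inl (by rw [eS_succ, gapAt_eq_one h])

/-- `eS (j+1) ≤ eS j + s_i`-type control: every step is `1` or some `s_i` with `eS j = a_i`. -/
theorem eS_succ_le_two_mul (j : ℕ) (hj : 1 ≤ eS j) : eS (j + 1) < 2 * eS j + 1 := by
  rcases eS_step j with h | ⟨i, hi, h1, h2⟩
  · omega
  · have := sI_lt_two_pow i
    have h3 : 2 ^ i ≤ aI i := by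
      have := succ_le_aI i; have := Nat.lt_two_pow_self (n := i)
      -- `2^i ≤ (2^i)! < 2^{a_i}` gives `i < a_i`; we need `2^i ≤ a_i`? use `a_i ≥ (i-1)2^{i-1}+1`
      obtain ⟨k, rfl⟩ : ∃ k, i = k + 1 := ⟨i - 1, by omega⟩
      have h4 := mul_two_pow_lt_aI k
      have hk : 3 ≤ k := by omega
      calc 2 ^ (k + 1) = 2 * 2 ^ k := by ring
        _ ≤ k * 2 ^ k + 1 := by nlinarith [Nat.one_le_two_pow (n := k)]
        _ ≤ aI (k + 1) := h4
    omega

/-- a run of filler steps between `y` and `z` when no anchor lies in `[y, z)`. -/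
theorem eS_run {j y z : ℕ} (hj : eS j = y) (hyz : y ≤ z)
    (hfree : ∀ x, y ≤ x → x < z → ∀ i, 4 ≤ i → aI i ≠ x) : eS (j + (z - y)) = z := by
  have key : ∀ t, t ≤ z - y → eS (j + t) = y + t := by
    intro t
    induction t with
    | zero => intro _; simpa using hj
    | succ t ih =>
      intro ht
      have e1 : j + (t + 1) = (j + t) + 1 := by omega
      rw [e1, eS_succ, ih (by omega), gapAt_eq_one (hfree (y + t) (by omega) (by omega))]
      omega
  rw [key (z - y) le_rfl]; omega

/-- every anchor `a_i` (`i ≥ 4`) is a kept exponent. -/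
theorem eS_hits_aI {i : ℕ} (hi : 4 ≤ i) : ∃ j, eS j = aI i := by
  induction i, hi using Nat.le_induction with
  | base =>
    refine ⟨0 + (aI 4 - 0), eS_run (j := 0) (y := 0) rfl (Nat.zero_le _) ?_⟩
    intro x _ hx k hk heq
    have := aI_strictMono.monotone hk
    omega
  | succ i hi ih =>
    obtain ⟨j, hj⟩ := ih
    have hj1 : eS (j + 1) = aI i + sI i := by rw [eS_succ, hj, gapAt_aI hi]
    have hlt := aI_add_sI_lt i
    refine ⟨(j + 1) + (aI (i + 1) - (aI i + sI i)), eS_run hj1 hlt.le ?_⟩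
    intro x hx1 hx2 k hk heq
    by_cases hki : k ≤ i
    · have := aI_strictMono.monotone hki
      have := four_le_sI hi
      omega
    · have := aI_strictMono.monotone (show i + 1 ≤ k by omega)
      omega

/-- **anchor hit**: for `i ≥ 4` some kept index `j` has `e_j = a_i` and `e_{j+1} = a_i + s_i`
(the deleted block). -/
theorem eS_anchor {i : ℕ} (hi : 4 ≤ i) : ∃ j, eS j = aI i ∧ eS (j + 1) = aI i + sI i := by
  obtain ⟨j, hj⟩ := eS_hits_aI hi
  exact ⟨j, hj, by rw [eS_succ, hj, gapAt_aI hi]⟩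

/-- **positions** `c_j = 2^{e_j}` (a sub-sequence of the Fredholm/Kempner exponents `2^n`). -/
def cS (j : ℕ) : ℕ := 2 ^ eS j

/-- `cS` is strictly increasing. -/
theorem cS_strictMono : StrictMono cS := fun _ _ h =>
  Nat.pow_lt_pow_right (by norm_num) (eS_strictMono h)

/-- `cS j < cS (j+1)`. -/
theorem cS_lt_succ (j : ℕ) : cS j < cS (j + 1) := cS_strictMono (Nat.lt_succ_self j)

/-- `2 · c_j ≤ c_{j+1}`. -/
theorem two_mul_cS_le_succ (j : ℕ) : 2 * cS j ≤ cS (j + 1) := by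
  unfold cS
  rw [← pow_succ']
  exact Nat.pow_le_pow_right two_pos (eS_lt_succ j)

/-- `j ≤ c_j`. -/
theorem self_le_cS (j : ℕ) : j ≤ cS j := (le_eS j).trans (Nat.lt_two_pow_self).le

/-- `1 ≤ c_j`. -/
theorem one_le_cS (j : ℕ) : 1 ≤ cS j := Nat.one_le_two_pow

/-- `cS N + j ≤ cS (N + j)`. -/
theorem cS_add_le (N j : ℕ) : cS N + j ≤ cS (N + j) := by
  induction j with
  | zero => simp
  | succ j ih =>
    have h1 := cS_lt_succ (N + j)
    have e : N + (j + 1) = (N + j) + 1 := by omega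
    rw [e]; omega

/-- the terms `2^{−c_j}`. -/
noncomputable def aS (j : ℕ) : ℝ := 1 / (2 : ℝ) ^ cS j

/-- `0 < aS j`. -/
theorem aS_pos (j : ℕ) : 0 < aS j := by unfold aS; positivity

/-- `aS j ≤ (1/2)^j`. -/
theorem aS_le_geom (j : ℕ) : aS j ≤ (1 / 2 : ℝ) ^ j := by
  unfold aS
  rw [one_div_pow]
  exact one_div_le_one_div_of_le (by positivity) (pow_le_pow_right₀ (by norm_num) (self_le_cS j))

/-- `Summable aS`. -/
theorem summable_aS : Summable aS :=
  Summable.of_nonneg_of_le (fun j => (aS_pos j).le) aS_le_geom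
    (summable_geometric_of_lt_one (by norm_num) (by norm_num))

end Member

end Summit.Schanuel.Schanuel.Theorems.RootDecomp1KSkelCell
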